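import Summits.QuantumFields.YangMills.Theorems.BalabanUVNodesN15CovariantLandauTwoGridGrad
import HarnessLib

/-!
# Route «BalabanUVNodes», node N15 = NE2, road (c) — PROGRAMME (P-S), XXXVII: THE ONE-GRID ROW OF THE BACKWARD-GRADIENT KERNEL `S̄ₕ∂G′(1)` FROM THE ROW OF `∂G′(1)` (the back shift along a bond's own
# direction moves its base point to the same unit block or a neighbour: cost `e^{θ}`) — discharges the inputs `C_D̄, C_D̄′` of n15-c∕237∕240–243 from n15-c∕220 (dag-n15-c g24, n15-c∕244)

Cell `pub-ymgap`, seat `pub-ymgap-dag-n15-c` (generation g24; R134 (a), s1; HUMAN RULING D-0062; chair R424 venue).  `bears_on: R4∕N15 · K3⁸ SpineGivenEndpointR13SepCoPHV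
(stmt-QuantumFields-27366)`; filed `--supports stmt-QuantumFields-27366 --as helper` — COUNT-NEUTRAL.  Theorems only; 0 `sorry`.  Imports BY NAME n15-c∕237 (`bBack`, `bBack_mulVec`), dag-n15-c g3
(`hasMaj_pull_comp`, `tdistT_blockOf_sub_unitVec_le`), [King1986] torus metric (`tdistT_triangle`, `tdistT_symm`).  Nothing in the tree is modified.

* `mulVecLin_bBack_eq_pull` (`S̄ₕ` is the pull-back along `((z, μ), i) ↦ ((z − e_μ, μ), i)`), ★ **`hasMaj_bBack_comp`**: `T ≤ Be^{−θd} ⟹ S̄ₕ∘T ≤ Be^{θ}e^{−θd}` (coloured bond carrier, unit blocks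
  of the base point), ★ `hasMaj_bBack_mul` (matrix-product form `S̄ₕ·A` as consumed by n15-c∕237: `C_D̄ := C_De^{θ}`).

HONEST FRAMING ∕ LIMITS.  Block-majorant bookkeeping; no propagator estimate; MODEL carriers; NOT [Balaban1985BackgroundPropagators] as printed; NE2⁺ NOT PRINTED; N15 of record untouched (DISCHARGED AS
CONSUMED, p687738); counts UNMOVED (typed 28∕28 · discharged 8∕27).  Restate-immune.
-/

noncomputable section

open scoped BigOperators Matrix
open Finset

namespace Summit.QuantumFields.YangMills.BalabanUVNodes.N15.CovLandau

open Literature.MathematicalPhysics.QuantumFieldTheory.Balaban1983to89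
open Literature.MathematicalPhysics.QuantumFieldTheory.Balaban1983to89.B5Prop11Plancherel (Tor fine unitVec)
open Literature.MathematicalPhysics.QuantumFieldTheory.Balaban1983to89.B11SectG (BlockNorm HasMaj)
open Literature.MathematicalPhysics.QuantumFieldTheory.Balaban1983to89.B6UnitTorusCarrier (unitTorusGeo)
open Literature.MathematicalPhysics.QuantumFieldTheory.Balaban1983to89.T4EtaRateCoeffDefect (pull pull_apply)
open Literature.MathematicalPhysics.QuantumFieldTheory.King1986.Torus (blockOf tdistT tdistT_triangle tdistT_symm)
open Summit.QuantumFields.YangMills.BalabanUVNodes.N15.MatrixSpecies (liftBlk)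
open Summit.QuantumFields.YangMills.BalabanUVNodes.N15.VectorPiece (hasMaj_pull_comp tdistT_blockOf_sub_unitVec_le)

variable {d : ℕ}

section Back

variable (M : Fin (d + 1) → ℕ) [∀ μ, NeZero (M μ)] (nn : ℕ) [NeZero nn] {ι : Type} [Fintype ι] [DecidableEq ι] (L k : ℕ)

/-- `S̄ₕ` is the pull-back along `((z, μ), i) ↦ ((z − e_μ, μ), i)`. [folklore] -/
theorem mulVecLin_bBack_eq_pull :
    Matrix.mulVecLin (bBack M nn (ι := ι)) = pull (fun p : (Tor (fine nn M) × Fin (d + 1)) × ι => ((p.1.1 - unitVec (fine nn M) p.1.2, p.1.2), p.2)) := by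
  refine LinearMap.ext fun ω => funext fun p => ?_
  obtain ⟨⟨z, μ⟩, i⟩ := p
  rw [Matrix.mulVecLin_apply, bBack_mulVec, pull_apply]

variable {F₁ : Type} [AddCommGroup F₁] [Module ℝ F₁]

/-- ★ **THE BACK SHIFT COSTS A FACTOR `e^{θ}`** on the coloured bond carrier blocked by the unit block of the base point. [cite: Balaban1984PropagatorsII, (2.52)–(2.55) pp.232–233 (block-majorant bookkeeping, shape)] -/
theorem hasMaj_bBack_comp {b₁ : BlockNorm (unitTorusGeo L k M) F₁} {T : F₁ →ₗ[ℝ] ((Tor (fine nn M) × Fin (d + 1)) × ι → ℝ)} {B θ : ℝ} (hB : 0 ≤ B) (hθ : 0 ≤ θ)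
    (h : HasMaj b₁ (BlockNorm.ofBlocks (unitTorusGeo L k M) (liftBlk (fun b : Tor (fine nn M) × Fin (d + 1) => blockOf nn M b.1) ι)) T (fun y y' => B * Real.exp (-(θ * tdistT M y y')))) :
    HasMaj b₁ (BlockNorm.ofBlocks (unitTorusGeo L k M) (liftBlk (fun b : Tor (fine nn M) × Fin (d + 1) => blockOf nn M b.1) ι)) (Matrix.mulVecLin (bBack M nn (ι := ι)) ∘ₗ T)
      (fun y y' => B * Real.exp θ * Real.exp (-(θ * tdistT M y y'))) := by
  rw [mulVecLin_bBack_eq_pull]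
  refine hasMaj_pull_comp (g := unitTorusGeo L k M) (liftBlk (fun b : Tor (fine nn M) × Fin (d + 1) => blockOf nn M b.1) ι)
    (fun p : (Tor (fine nn M) × Fin (d + 1)) × ι => ((p.1.1 - unitVec (fine nn M) p.1.2, p.1.2), p.2))
    (fun _ _ => mul_nonneg (mul_nonneg hB (Real.exp_nonneg _)) (Real.exp_nonneg _)) (fun p y' => ?_) h
  show B * Real.exp (-(θ * tdistT M (blockOf nn M (p.1.1 - unitVec (fine nn M) p.1.2)) y')) ≤ B * Real.exp θ * Real.exp (-(θ * tdistT M (blockOf nn M p.1.1) y'))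
  rw [mul_assoc, ← Real.exp_add]
  refine mul_le_mul_of_nonneg_left (Real.exp_le_exp.mpr ?_) hB
  have h1 := tdistT_triangle M (blockOf nn M p.1.1) (blockOf nn M (p.1.1 - unitVec (fine nn M) p.1.2)) y'
  have h2 : tdistT M (blockOf nn M p.1.1) (blockOf nn M (p.1.1 - unitVec (fine nn M) p.1.2)) ≤ 1 := by
    rw [tdistT_symm]; exact tdistT_blockOf_sub_unitVec_le nn M p.1.1 p.1.2
  nlinarith

/-- ★ **THE ROW OF `S̄ₕ·A`** (matrix-product form, as consumed by n15-c∕237's `hD1b`∕`hDDb` and 240–243): `A ≤ C·e^{−θd} ⟹ S̄ₕA ≤ Ce^{θ}·e^{−θd}` — with `A = ∂G′(1)` (n15-c∕220) this is the input `C_D̄`.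
[cite: Balaban1984PropagatorsII, (2.52)–(2.55) pp.232–233 (shape)] -/
theorem hasMaj_bBack_mul {A : Matrix ((Tor (fine nn M) × Fin (d + 1)) × ι) (Tor (fine nn M) × ι) ℝ} {C θ : ℝ} (hC : 0 ≤ C) (hθ : 0 ≤ θ)
    (h : HasMaj (BlockNorm.ofBlocks (unitTorusGeo L k M) (liftBlk (blockOf nn M) ι)) (BlockNorm.ofBlocks (unitTorusGeo L k M) (liftBlk (fun b : Tor (fine nn M) × Fin (d + 1) => blockOf nn M b.1) ι)) (Matrix.mulVecLin A)
      (fun y y' => C * Real.exp (-(θ * tdistT M y y')))) :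
    HasMaj (BlockNorm.ofBlocks (unitTorusGeo L k M) (liftBlk (blockOf nn M) ι)) (BlockNorm.ofBlocks (unitTorusGeo L k M) (liftBlk (fun b : Tor (fine nn M) × Fin (d + 1) => blockOf nn M b.1) ι))
      (Matrix.mulVecLin (bBack M nn (ι := ι) * A)) (fun y y' => C * Real.exp θ * Real.exp (-(θ * tdistT M y y'))) := by
  rw [Matrix.mulVecLin_mul]
  exact hasMaj_bBack_comp M nn L k hC hθ h

end Back

end Summit.QuantumFields.YangMills.BalabanUVNodes.N15.CovLandau

end
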